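import Summits.AtomisticToContinuum.HydrodynamicLimit.Theorems.JParityClosureRateFloorMarkedTransfer
import HarnessLib

/-!
# Pre-emption charge (`stub_preemptionCharge`, registered stub S10 of the line `Sketch`
# of the crux `JParityClosure.RateFloor`, stmt-AtomisticToContinuum-13080)

Helper file (`--supports stmt-AtomisticToContinuum-13080`) discharging the registered stub S10
`stub_preemptionCharge` of the lead's skeleton for the crux `JParityClosure.RateFloor`, line
`Sketch`, stated exactly as registered (hypotheses-by-equation style of S6d/S9).

**Statement.**  On a hard-sphere trajectory `γ` on `𝕋³` with diameter `0 < ε < 1/2`, fix a window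
`(s, t]`, a mark `F` bounded by `M ≥ 0` on the window, and for every ordered pair `p` the first
near-contact time `t₁ p` of the free flights issued from `γ s`.  Let `W` be the ordered WOULD-BE
pairs (distinct, free flights within `ε` at some time of `(0, t − s]`), `R ⊆ W` the REALISED ones
(neither endpoint takes part in a collision during `(s, s + t₁ p)`), `C ⊆ W` the would-be pairs with
an endpoint of would-be out-degree `≥ 2`, and `S` the number of SECONDARY contact incidences of the
window: over the collision times `u ∈ (s, t]`, the ordered contact pairs of `γ u` a member of which
already took part in a collision during `(s, u)`.  Then the would-be marked sum (marks read at the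
free-flight-predicted datum) is at most the realised one plus `M · (#C + S)`.

**Proof.**  (1) `R ⊆ W` and every would-be term is `≤ M`, because `t₁ p ∈ (0, t − s]`
(`RateFloorMarkedTransfer.first_contact`), so it suffices to count: `#(W ∖ R) ≤ #C + S`, i.e.
`#((W ∖ R) ∖ C) ≤ S`.  (2) For `p ∈ (W ∖ R) ∖ C` let `u₀ ∈ (s, s + t₁ p)` be the FIRST collision
time at which an endpoint `e` of `p` takes part, with partner `k`.  The partner is STALE (it took
part in a collision during `(s, u₀)`): otherwise `e` and `k` are both undeflected on `(s, u₀)`, so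
(`RateFloorMarkedTransfer.apply_fst_eq_freeFlight_of_not_participates`) their free flights are in
contact at time `u₀ − s`, `(e, k)` is would-be, and since the would-be out-degree of `e` is `≤ 1`
(`p ∉ C`; `W` is symmetric) `k` is the other endpoint of `p`; then the free flights of `p` are in
contact at `u₀ − s < t₁ p`, contradicting the minimality of `t₁ p = inf {…}`.  (3) The map
`p ↦ (u₀, (p.1, k))` (if `e = p.1`) / `(u₀, (k, p.2))` (if `e = p.2`) lands in the secondary
contact incidences and is injective on `(W ∖ R) ∖ C`: equal images with the same orientation share
an endpoint of out-degree `≤ 1`, and opposite orientations would make an endpoint of `p` both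
undeflected on `(s, u₀)` (minimality of `u₀`) and stale.  The counting core is isolated in the
abstract lemma `card_le_secondary`.

References: Gallagher–Saint-Raymond–Texier 2013 §4.1 (hard-sphere trajectories); elementary.
-/

noncomputable section

open scoped Classical BigOperators

namespace Summit.AtomisticToContinuum.HydrodynamicLimit.Theorems

open MeasureTheory Set Filter Topology
open Literature.Analysis.FluidPDE Literature.MathematicalPhysics.KineticTheory

namespace RateFloorPreemptionCharge

/-! ### The counting core -/

/-- **Counting core of the pre-emption charge** (abstract form).  `near u p`: the free flights of
the pair `p` are within `ε` at time `u`; `t₁ p`: its first near-contact time in `(0, t − s]`;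
`Part u k`: particle `k` takes part in a collision at time `u`; `CP u`: the ordered contact pairs at
time `u`; `T ⊇` the collision times of `(s, t]`; `W`: the would-be pairs.  If every `p ∈ D` is
would-be, has an endpoint deflected during `(s, s + t₁ p)`, and both its endpoints have would-be
out-degree `≤ 1`, then `#D` is at most the number of secondary contact incidences
`∑_{u ∈ T} #{q ∈ CP u | q.1 or q.2 took part in a collision during (s, u)}`: charge `p` to its first
pre-empting collision, whose partner is stale (steps (2)–(3) of the file header). [folklore] -/
theorem card_le_secondary {ι : Type*} {s t : ℝ} {near : ℝ → ι × ι → Prop} {t₁ : ι × ι → ℝ}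
    {Part : ℝ → ι → Prop} {CP : ℝ → Finset (ι × ι)} {T : Finset ℝ} {W D : Finset (ι × ι)}
    (hT : ∀ u ∈ T, s < u) (hK1 : ∀ p ∈ W, t₁ p ∈ Ioc 0 (t - s))
    (hK2 : ∀ p u, u ∈ Ioc 0 (t - s) → near u p → t₁ p ≤ u)
    (hK3 : ∀ u p, near u p → near u p.swap)
    (hWin : ∀ p : ι × ι, p.1 ≠ p.2 → ∀ u ∈ Ioc 0 (t - s), near u p → p ∈ W)
    (hWswap : ∀ p ∈ W, p.swap ∈ W)
    (hK4 : ∀ u e k, s < u → (e, k) ∈ CP u → (∀ u' ∈ Ioo s u, ¬ Part u' e) →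
      (∀ u' ∈ Ioo s u, ¬ Part u' k) → near (u - s) (e, k))
    (hK5 : ∀ u e, Part u e → ∃ k, (e, k) ∈ CP u)
    (hK6 : ∀ u q, q ∈ CP u → q.swap ∈ CP u ∧ q.1 ≠ q.2)
    (hK7 : ∀ u e, s < u → u ≤ t → Part u e → u ∈ T)
    (hD : ∀ p ∈ D, p ∈ W ∧ (∃ u ∈ Ioo s (s + t₁ p), Part u p.1 ∨ Part u p.2) ∧
      ∀ q ∈ W, ∀ q' ∈ W, (q.1 = p.1 ∨ q.1 = p.2) → q'.1 = q.1 → q = q') :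
    D.card ≤ ∑ u ∈ T, ((CP u).filter fun q =>
      ∃ u' ∈ Ioo s u, Part u' q.1 ∨ Part u' q.2).card := by
  classical
  -- (2) every `p ∈ D` is charged to a secondary contact incidence `x = ⟨u₀, q⟩`
  have hex : ∀ p : ι × ι, ∃ x : (Σ _ : ℝ, ι × ι), p ∈ D →
      (x ∈ T.sigma fun u => (CP u).filter fun q =>
        ∃ u' ∈ Ioo s u, Part u' q.1 ∨ Part u' q.2) ∧
      (∀ u' ∈ Ioo s x.1, ¬ (Part u' p.1 ∨ Part u' p.2)) ∧
      (x.2.1 = p.1 ∧ (∃ u' ∈ Ioo s x.1, Part u' x.2.2) ∨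
        x.2.2 = p.2 ∧ (∃ u' ∈ Ioo s x.1, Part u' x.2.1)) := by
    intro p
    by_cases hpD : p ∈ D
    swap
    · exact ⟨⟨0, p⟩, fun hp => absurd hp hpD⟩
    obtain ⟨hpW, hpre, hdeg⟩ := hD p hpD
    have ht₁p := hK1 p hpW
    -- the first pre-emption time `u₀`
    obtain ⟨u₀, ⟨hu₀, hP₀⟩, hmin⟩ : ∃ u₀, (u₀ ∈ Ioo s (s + t₁ p) ∧ (Part u₀ p.1 ∨ Part u₀ p.2)) ∧
        ∀ u' ∈ Ioo s u₀, ¬ (Part u' p.1 ∨ Part u' p.2) := by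
      set Tp := T.filter fun u => u < s + t₁ p ∧ (Part u p.1 ∨ Part u p.2) with hTp
      have hmem : ∀ u, u ∈ Tp ↔ u ∈ Ioo s (s + t₁ p) ∧ (Part u p.1 ∨ Part u p.2) := fun u => by
        simp only [hTp, Finset.mem_filter, Set.mem_Ioo]
        refine ⟨fun h => ⟨⟨hT u h.1, h.2.1⟩, h.2.2⟩, fun h => ⟨?_, h.1.2, h.2⟩⟩
        have hut : u ≤ t := by linarith [h.1.2, ht₁p.2]
        exact h.2.elim (hK7 u _ h.1.1 hut) (hK7 u _ h.1.1 hut)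
      have hne : Tp.Nonempty := hpre.imp fun u hu => (hmem u).2 hu
      refine ⟨Tp.min' hne, (hmem _).1 (Tp.min'_mem hne), fun u' hu' hP' => ?_⟩
      have h' := (hmem _).1 (Tp.min'_mem hne)
      exact (Tp.min'_le u' ((hmem u').2 ⟨⟨hu'.1, hu'.2.trans h'.1.2⟩, hP'⟩)).not_gt hu'.2
    have hsu₀ : s < u₀ := hu₀.1
    have hu₀t : u₀ ≤ t := by linarith [hu₀.2, ht₁p.2]
    have hws : u₀ - s ∈ Ioc 0 (t - s) := ⟨sub_pos.2 hsu₀, by linarith⟩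
    have hlt : u₀ - s < t₁ p := by linarith [hu₀.2]
    have hf1 : ∀ u' ∈ Ioo s u₀, ¬ Part u' p.1 := fun u' hu' h1 => hmin u' hu' (Or.inl h1)
    have hf2 : ∀ u' ∈ Ioo s u₀, ¬ Part u' p.2 := fun u' hu' h2 => hmin u' hu' (Or.inr h2)
    have hu₀T : u₀ ∈ T := hP₀.elim (hK7 u₀ _ hsu₀ hu₀t) (hK7 u₀ _ hsu₀ hu₀t)
    -- the participating endpoint `e ∈ {p.1, p.2}` and its partner `k`, which is stale
    obtain ⟨e, he, hPe⟩ : ∃ e, (e = p.1 ∨ e = p.2) ∧ Part u₀ e :=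
      hP₀.elim (fun h1 => ⟨_, Or.inl rfl, h1⟩) fun h2 => ⟨_, Or.inr rfl, h2⟩
    obtain ⟨k, hek⟩ := hK5 u₀ e hPe
    have hef : ∀ u' ∈ Ioo s u₀, ¬ Part u' e := by
      rcases he with rfl | rfl
      exacts [hf1, hf2]
    have hstale : ∃ u' ∈ Ioo s u₀, Part u' k := by
      by_contra hk
      push Not at hk
      have hnear : near (u₀ - s) (e, k) := hK4 u₀ e k hsu₀ hek hef hk
      have hekW : (e, k) ∈ W := hWin (e, k) (hK6 u₀ _ hek).2 (u₀ - s) hws hnear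
      rcases he with rfl | rfl
      · have hpk : p = (p.1, k) := hdeg p hpW (p.1, k) hekW (Or.inl rfl) rfl
        rw [← hpk] at hnear
        exact hlt.not_ge (hK2 p _ hws hnear)
      · have hpk : p.swap = (p.2, k) := hdeg p.swap (hWswap p hpW) (p.2, k) hekW (Or.inr rfl) rfl
        rw [← hpk] at hnear
        exact hlt.not_ge (hK2 p _ hws (by simpa only [Prod.swap_swap] using hK3 _ _ hnear))
    rcases he with rfl | rfl
    · exact ⟨⟨u₀, (p.1, k)⟩, fun _ => ⟨Finset.mem_sigma.2 ⟨hu₀T, Finset.mem_filter.2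
        ⟨hek, hstale.imp fun u' hu' => ⟨hu'.1, Or.inr hu'.2⟩⟩⟩, hmin, Or.inl ⟨rfl, hstale⟩⟩⟩
    · exact ⟨⟨u₀, (k, p.2)⟩, fun _ => ⟨Finset.mem_sigma.2 ⟨hu₀T, Finset.mem_filter.2
        ⟨(hK6 u₀ _ hek).1, hstale.imp fun u' hu' => ⟨hu'.1, Or.inl hu'.2⟩⟩⟩, hmin,
        Or.inr ⟨rfl, hstale⟩⟩⟩
  -- (3) the charge is injective on `D`
  choose Φ hΦ using hex
  calc D.card ≤ (T.sigma fun u => (CP u).filter fun q =>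
        ∃ u' ∈ Ioo s u, Part u' q.1 ∨ Part u' q.2).card := by
        refine Finset.card_le_card_of_injOn Φ
          (fun p hp => Finset.mem_coe.2 (hΦ p (Finset.mem_coe.1 hp)).1) ?_
        intro p hp p' hp' hΦeq
        obtain ⟨-, hminp, hp3⟩ := hΦ p (Finset.mem_coe.1 hp)
        obtain ⟨-, -, hp3'⟩ := hΦ p' (Finset.mem_coe.1 hp')
        obtain ⟨hpW, -, hdeg⟩ := hD p (Finset.mem_coe.1 hp)
        have hp'W := (hD p' (Finset.mem_coe.1 hp')).1
        rw [hΦeq] at hminp hp3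
        rcases hp3 with ⟨h1, -⟩ | ⟨h2, -⟩ <;> rcases hp3' with ⟨h1', hst'⟩ | ⟨h2', hst'⟩
        · exact hdeg p hpW p' hp'W (Or.inl rfl) (h1'.symm.trans h1)
        · obtain ⟨u', hu', hP⟩ := hst'
          rw [h1] at hP
          exact (hminp u' hu' (Or.inl hP)).elim
        · obtain ⟨u', hu', hP⟩ := hst'
          rw [h2] at hP
          exact (hminp u' hu' (Or.inr hP)).elim
        · exact Prod.swap_inj.1 (hdeg p.swap (hWswap p hpW) p'.swap (hWswap p' hp'W)
            (Or.inr rfl) (h2'.symm.trans h2))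
    _ = _ := Finset.card_sigma _ _

/-! ### The stub -/

/-- **S10 · pre-emption charge** (registered stub `stub_preemptionCharge` of the line `Sketch`
for `JParityClosure.RateFloor`, stmt-AtomisticToContinuum-13080, verbatim).  On a hard-sphere
trajectory on `𝕋³` with `0 < ε < 1/2` and a window `(s, t]`, for a mark `F` bounded by `M ≥ 0` on
the window: the would-be marked sum is at most the realised marked sum plus `M · (#C + S)`, `C` the
would-be pairs with an endpoint of would-be out-degree `≥ 2` and `S` the number of secondary contact
incidences of the window.  Every would-be term is `≤ M` (`RateFloorMarkedTransfer.first_contact`),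
and `#((W ∖ R) ∖ C) ≤ S` by `card_le_secondary` fed with the trajectory kinematics
(`RateFloorMarkedTransfer.apply_fst_eq_freeFlight_of_not_participates`, binary symmetric contact
pairs, local finiteness of the collision times). [folklore] -/
theorem stub_preemptionCharge :
    ∀ (N : ℕ) (ε : ℝ) (γ : ℝ → Config N (Fin 3) T3),
    IsHardSphereTrajectory (Torus.geometry (Fin 3)) ε N γ → 0 < ε → ε < 2⁻¹ →
    ∀ (s t : ℝ), s < t →
      ∀ (F : ℝ → T3 → T3 → V3 → V3 → ℝ) (M : ℝ), 0 ≤ M →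
      (∀ u ∈ Set.Ioc s t, ∀ x y v w, F u x y v w ≤ M) →
      ∀ (t₁ : Fin N × Fin N → ℝ),
      (∀ p, t₁ p = sInf {u : ℝ | u ∈ Set.Ioc 0 (t - s) ∧ ‖(Torus.geometry (Fin 3)).sepVec
          (freeFlight (Torus.geometry (Fin 3)) u (γ s) p.1).1 (freeFlight (Torus.geometry (Fin 3)) u (γ s) p.2).1‖ ≤ ε}) →
      ∀ (W : Finset (Fin N × Fin N)),
      (W = Finset.univ.filter fun p => p.1 ≠ p.2 ∧
        ∃ u ∈ Set.Ioc 0 (t - s), ‖(Torus.geometry (Fin 3)).sepVec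
          (freeFlight (Torus.geometry (Fin 3)) u (γ s) p.1).1 (freeFlight (Torus.geometry (Fin 3)) u (γ s) p.2).1‖ ≤ ε) →
      ∀ (R : Finset (Fin N × Fin N)),
      (R = Finset.univ.filter fun p => p.1 ≠ p.2 ∧
        (∃ u ∈ Set.Ioc 0 (t - s), ‖(Torus.geometry (Fin 3)).sepVec
          (freeFlight (Torus.geometry (Fin 3)) u (γ s) p.1).1 (freeFlight (Torus.geometry (Fin 3)) u (γ s) p.2).1‖ ≤ ε) ∧
        (∀ u ∈ Set.Ioo s (s + t₁ p), ¬ Participates (Torus.geometry (Fin 3)) ε (γ u) p.1) ∧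
        (∀ u ∈ Set.Ioo s (s + t₁ p), ¬ Participates (Torus.geometry (Fin 3)) ε (γ u) p.2)) →
      ∀ (C : Finset (Fin N × Fin N)),
      (C = W.filter fun p => 2 ≤ (W.filter fun q => q.1 = p.1).card ∨ 2 ≤ (W.filter fun q => q.1 = p.2).card) →
      ∀ (S : ℕ),
      (S = ∑ᶠ (u : ℝ) (_ : u ∈ collisionTimes (Torus.geometry (Fin 3)) ε γ ∩ Set.Ioc s t),
        ((contactPairs (Torus.geometry (Fin 3)) ε (γ u)).filter fun q =>
          ∃ u' ∈ Set.Ioo s u, Participates (Torus.geometry (Fin 3)) ε (γ u') q.1 ∨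
            Participates (Torus.geometry (Fin 3)) ε (γ u') q.2).card) →
      ∑ p ∈ W, F (s + t₁ p) (freeFlight (Torus.geometry (Fin 3)) (t₁ p) (γ s) p.1).1
          (freeFlight (Torus.geometry (Fin 3)) (t₁ p) (γ s) p.2).1 ((γ s p.1).2) ((γ s p.2).2) ≤
        ∑ p ∈ R, F (s + t₁ p) (freeFlight (Torus.geometry (Fin 3)) (t₁ p) (γ s) p.1).1
          (freeFlight (Torus.geometry (Fin 3)) (t₁ p) (γ s) p.2).1 ((γ s p.1).2) ((γ s p.2).2) +
        M * ((C.card : ℝ) + (S : ℝ)) := by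
  intro N ε γ h _hε hε2 s t _hst F M hM hFM t₁ ht₁ W hW R hR C hC S hS
  have hG : (Torus.geometry (Fin 3)).IsHardSphereRegular ε := Torus.isHardSphereRegular_geometry hε2
  -- membership in `W` and `R`
  have hWmem : ∀ p, p ∈ W ↔ p.1 ≠ p.2 ∧ ∃ u ∈ Set.Ioc 0 (t - s), ‖(Torus.geometry (Fin 3)).sepVec
      (freeFlight (Torus.geometry (Fin 3)) u (γ s) p.1).1
      (freeFlight (Torus.geometry (Fin 3)) u (γ s) p.2).1‖ ≤ ε := fun p => by
    rw [hW, Finset.mem_filter, and_iff_right (Finset.mem_univ _)]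
  have hRmem : ∀ p, p ∈ R ↔ p ∈ W ∧
      (∀ u ∈ Set.Ioo s (s + t₁ p), ¬ Participates (Torus.geometry (Fin 3)) ε (γ u) p.1) ∧
      (∀ u ∈ Set.Ioo s (s + t₁ p), ¬ Participates (Torus.geometry (Fin 3)) ε (γ u) p.2) :=
    fun p => by rw [hR, hWmem, Finset.mem_filter, and_iff_right (Finset.mem_univ _), and_assoc]
  have hRW : R ⊆ W := fun p hp => ((hRmem p).1 hp).1
  -- (1) the first free contact time of a would-be pair lies in `(0, t - s]`
  have hK1 : ∀ p ∈ W, t₁ p ∈ Set.Ioc 0 (t - s) := by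
    intro p hp
    obtain ⟨hne, hex⟩ := (hWmem p).1 hp
    obtain ⟨δ, hδ, hsep⟩ := RateFloorWindowPreemption.exists_sep_window h hε2 s hne
    have hcont : Continuous fun u : ℝ => ‖(Torus.geometry (Fin 3)).sepVec
        (freeFlight (Torus.geometry (Fin 3)) u (γ s) p.1).1
        (freeFlight (Torus.geometry (Fin 3)) u (γ s) p.2).1‖ := by
      simpa only [Function.comp_def] using
        (hG.continuous_norm_sepVec_config p.1 p.2).comp (hG.continuous_freeFlight (γ s))
    exact (RateFloorMarkedTransfer.first_contact hcont hδ hsep hex (ht₁ p)).1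
  -- near contact of the free flights is symmetric in the pair
  have hK3 : ∀ (u : ℝ) (p : Fin N × Fin N), ‖(Torus.geometry (Fin 3)).sepVec
      (freeFlight (Torus.geometry (Fin 3)) u (γ s) p.1).1
      (freeFlight (Torus.geometry (Fin 3)) u (γ s) p.2).1‖ ≤ ε → ‖(Torus.geometry (Fin 3)).sepVec
      (freeFlight (Torus.geometry (Fin 3)) u (γ s) p.swap.1).1
      (freeFlight (Torus.geometry (Fin 3)) u (γ s) p.swap.2).1‖ ≤ ε := fun u p hp => by
    rwa [Prod.fst_swap, Prod.snd_swap, hG.norm_sepVec_comm_of_le hp]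
  -- the collision times of the window are finitely many: `S` is a finite sum
  have hfin : (collisionTimes (Torus.geometry (Fin 3)) ε γ ∩ Set.Ioc s t).Finite :=
    h.finite_collisionTimes_inter_of_subset_Icc Set.Ioc_subset_Icc_self
  rw [finsum_mem_eq_finite_toFinset_sum _ hfin] at hS
  -- (2)-(3) the counting `#((W \ R) \ C) ≤ S`
  have hcount : ((W \ R) \ C).card ≤ S := by
    rw [hS]
    refine card_le_secondary (t₁ := t₁)
      (near := fun u p => ‖(Torus.geometry (Fin 3)).sepVec
        (freeFlight (Torus.geometry (Fin 3)) u (γ s) p.1).1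
        (freeFlight (Torus.geometry (Fin 3)) u (γ s) p.2).1‖ ≤ ε)
      (Part := fun u k => Participates (Torus.geometry (Fin 3)) ε (γ u) k)
      (CP := fun u => contactPairs (Torus.geometry (Fin 3)) ε (γ u))
      (fun u hu => (hfin.mem_toFinset.1 hu).2.1) hK1 ?_ hK3
      (fun p hne u hu hle => (hWmem p).2 ⟨hne, u, hu, hle⟩) ?_ ?_ ?_ ?_ ?_ ?_
    · -- `t₁ p` is a lower bound of the near-contact times
      intro p u hu hle
      rw [ht₁ p]
      exact csInf_le ⟨0, fun v hv => hv.1.1.le⟩ ⟨hu, hle⟩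
    · -- `W` is symmetric
      intro p hp
      obtain ⟨hne, u, hu, hle⟩ := (hWmem p).1 hp
      exact (hWmem _).2 ⟨hne.symm, u, hu, hK3 u p hle⟩
    · -- a contact of two undeflected particles is a contact of their free flights
      intro u e k hsu hek he hk
      obtain ⟨-, hnorm⟩ := (mem_contactPairs_iff_of_mem (h.mem u)).1 hek
      have hτ : 0 < u - s := sub_pos.2 hsu
      have h1 := RateFloorMarkedTransfer.apply_fst_eq_freeFlight_of_not_participates h (s := s) hτ
        (k := e) fun u' hu' => he u' (by rwa [add_sub_cancel] at hu')
      have h2 := RateFloorMarkedTransfer.apply_fst_eq_freeFlight_of_not_participates h (s := s) hτ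
        (k := k) fun u' hu' => hk u' (by rwa [add_sub_cancel] at hu')
      rw [add_sub_cancel] at h1 h2
      show ‖(Torus.geometry (Fin 3)).sepVec (freeFlight (Torus.geometry (Fin 3)) (u - s) (γ s) e).1
        (freeFlight (Torus.geometry (Fin 3)) (u - s) (γ s) k).1‖ ≤ ε
      rw [← h1, ← h2]
      exact hnorm.le
    · -- a participating particle is the first member of an ordered contact pair
      rintro u e ⟨k, hk | hk⟩
      exacts [⟨k, hk⟩, ⟨k, (swap_mem_contactPairs_iff hG (p := (e, k))).1 hk⟩]
    · exact fun u q hq => ⟨(swap_mem_contactPairs_iff hG).2 hq, (mem_contactPairs.1 hq).1⟩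
    · exact fun u e hsu hut hP =>
        hfin.mem_toFinset.2 ⟨collisionTimesOf_subset γ e (mem_collisionTimesOf.2 hP), hsu, hut⟩
    · -- the pairs of `(W \ R) \ C`: would-be, pre-empted, endpoints of out-degree `≤ 1`
      intro p hp
      rw [Finset.mem_sdiff, Finset.mem_sdiff, hC, Finset.mem_filter] at hp
      obtain ⟨⟨hpW, hpR⟩, hpC⟩ := hp
      have hC' : ¬ (2 ≤ (W.filter fun q => q.1 = p.1).card ∨
          2 ≤ (W.filter fun q => q.1 = p.2).card) := fun h' => hpC ⟨hpW, h'⟩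
      refine ⟨hpW, ?_, ?_⟩
      · by_contra hex
        push Not at hex
        exact hpR ((hRmem p).2 ⟨hpW, fun u hu => (hex u hu).1, fun u hu => (hex u hu).2⟩)
      · intro q hq q' hq' hq1 hq'1
        have hle : (W.filter fun r => r.1 = q.1).card ≤ 1 := by
          rcases hq1 with h1 | h1 <;> rw [h1] <;> omega
        exact Finset.card_le_one.1 hle q (Finset.mem_filter.2 ⟨hq, rfl⟩) q'
          (Finset.mem_filter.2 ⟨hq', hq'1⟩)
  -- (1) conclusion: split the would-be sum along `R ⊆ W` and bound the rest termwise by `M`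
  have hterm : ∀ p ∈ W \ R, F (s + t₁ p) (freeFlight (Torus.geometry (Fin 3)) (t₁ p) (γ s) p.1).1
      (freeFlight (Torus.geometry (Fin 3)) (t₁ p) (γ s) p.2).1 ((γ s p.1).2) ((γ s p.2).2) ≤ M :=
    fun p hp => hFM (s + t₁ p) ⟨by linarith [(hK1 p (Finset.mem_sdiff.1 hp).1).1],
      by linarith [(hK1 p (Finset.mem_sdiff.1 hp).1).2]⟩ _ _ _ _
  have h1 := Finset.sum_le_card_nsmul (W \ R) _ M hterm
  rw [nsmul_eq_mul] at h1
  have h2 : (W \ R).card ≤ C.card + S :=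
    (Finset.card_le_card_sdiff_add_card (s := W \ R) (t := C)).trans (by omega)
  have h3 : ((W \ R).card : ℝ) * M ≤ M * ((C.card : ℝ) + (S : ℝ)) := by
    rw [mul_comm]
    exact mul_le_mul_of_nonneg_left (by exact_mod_cast h2) hM
  rw [← Finset.sum_sdiff hRW]
  linarith

end RateFloorPreemptionCharge

end Summit.AtomisticToContinuum.HydrodynamicLimit.Theorems

end
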